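import Literature.AnabelianGeometry.EtaleTheta.Discharge.Sec3Remark363OfRlf
import Literature.AnabelianGeometry.EtaleTheta.Discharge.Sec3ConstantLineOfRlfWeak
import HarnessLib

/-!
# [EtTh] Remark 3.6.3 at the three CONSTRUCTED Def. 3.6 (i) data over the WEAK vocabulary
# `ofRlfZWeak`, `ofRlfQWeak`, `ofRlfRWeak` — unconditionally at monoid type `ℝ`

S. Mochizuki, *The étale theta function and its Frobenioid-theoretic manifestations*, Publ. RIMS **45**
(2009) [MochizukiEtTh2009], §3: Remark 3.6.3, PDF pp. 78–79 (printed 304–305): "the essential image of the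
natural functor `C^{bs-fld} → C` consists precisely of … the base-field-theoretic morphisms of `C` between
objects of the essential image. In particular, the natural functor `C^{bs-fld} → C` is isomorphism-full";
Definition 3.6 (i), PDF p. 76; Prop. 3.4 (ii), PDF p. 74 (the three isomorphisms
`O_L^× ⥲ Ker(B₀ → Φ₀^gp)`, `O_L^▷ ⥲ B₀ ×_{Φ₀^gp} Φ₀`, `L^× ⥲ F₀`).

WEAK-VOCABULARY TWIN of `Discharge/Sec3Remark363OfRlf.lean` (abc-iut-f-136; FACT-LIST row F-0581
`TemperedFrobenioid.Remark363`, consumable only through INSTANCE FORMS — the universal closure is REFUTED,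
`ToyFinv.not_remark363` / `TemperedFrobenioid.not_forall_remark363`).  That file evaluates the row at the strong
constructors `ofRlfZ` / `ofRlfQ` / `ofRlfR`, whose hypothesis (printed Prop. 3.4 (i) at every `Y`) is VACUOUS at
the tempered coverings `Ÿ`, `Z_∞` with infinitely many special-fibre components (cell finding F-L2d2-1).  Here
the same three instance theorems are proved at abc-iut-L6-t12's weak constructors `ofRlfZWeak` / `ofRlfQWeak` /
`ofRlfRWeak` (`hpf : ∀ Y, IsPerfFactorialCof (Φ₀ Y)`), by name from the vocabulary-generic instance forms
`remark363_of_mem_FΛ_of_cnstR` (abc-iut-f-136) / `remark363_of_isSharp` (abc-iut-w5-d135) with the weak inputs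
of `Sec3ConstantLineOfRlfWeak.lean` / `Sec3Prop34CnstOfRlfQWeak.lean` / `Sec3FLambdaInvOfRlfWeak.lean`
(`Φ(A)` of a tempered Frobenioid over the WEAK vocabulary is weakly perf-factorial, hence divisorial, hence sharp):

* **`remark363_ofRlfRWeak` — Remark 3.6.3 holds UNCONDITIONALLY for every tempered Frobenioid over the weak
  constructed data of monoid type `ℝ`** (`F₀^ℝ = B₀^ℝ ∩ ℝ·Φ₀^cnst`, so `hcomap` is the identity map);
* `remark363_ofRlfZWeak`, `remark363_ofRlfQWeak` — at monoid types `ℤ`, `ℚ`, Remark 3.6.3 modulo the typed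
  Prop. 3.4 structure `dm.Prop34` and the ONE `B₀`-level binder `hF₀inv` ("`F₀(Y) ≅ L^×` is a group",
  Prop. 3.4 (ii) third isomorphism; GAP row G-w5d135-1).

Seat abc-iut-L6-t12 (gen 4), cell abc-iut, row «§3 WEAK COLUMN at Λ = ℚ/ℝ» piece (W4).  PROOF-ONLY: no
definition, no instance; nothing of the paper is restated or strengthened; every input is consumed BY NAME.
HONEST FRAMING: refereed pre-IUT material ([EtTh] §3); nothing here bears on the disputed [IUTchIII] Cor. 3.12;
no side taken; typed ≠ proved for the rest of §3.
-/

namespace Literature.AnabelianGeometry.EtaleTheta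

open CategoryTheory Opposite Literature.AlgebraicGeometry.Frobenioids

universe u₀ v₀ u v w

namespace TemperedFrobenioid

variable {D₀ : Type u} [Category.{v} D₀] {dm : DivisorMonoids.{u, v, w} D₀}
  {hpf : ∀ Y : D₀ᵒᵖ, IsPerfFactorialCof (dm.Φ₀.obj Y)} {V : FrdIMonoidStub.{w}} {V₀ : FrdICatStub.{u, v, w} D₀}
  {D : Type u₀} [Category.{v₀} D] {VD : FrdICatStub.{u₀, v₀, w} D}

/-- **[EtTh] Remark 3.6.3 at monoid type `ℝ` over the WEAK vocabulary — UNCONDITIONAL** for every tempered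
Frobenioid over the weak constructed Def. 3.6 (i) data `RealifiedDivisorMonoids.ofRlfRWeak dm hpf`
(`B₀^ℝ = ℝ·Φ₀^birat`, `F₀^ℝ = B₀^ℝ ∩ ℝ·Φ₀^cnst`, so `hcomap` is the identity; `Φ(A)` is weakly perf-factorial at
the weak monoid vocabulary, hence divisorial and sharp). [cite: MochizukiEtTh2009, Rmk 3.6.3 p.79] -/
theorem remark363_ofRlfRWeak (C : TemperedFrobenioid (RealifiedDivisorMonoids.ofRlfRWeak dm hpf) D VD) :
    TemperedFrobenioid.Remark363 (T := RealifiedDivisorMonoids.ofRlfRWeak dm hpf) C :=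
  C.remark363_of_mem_FΛ_of_cnstR
    (fun A => Exists.elim (C.isPerfFactorial (op A)) fun hw _ => hw.isDivisorial.isSharp) fun _ _ h => h

/-- **[EtTh] Remark 3.6.3 at monoid type `ℤ` over the WEAK vocabulary** for every tempered Frobenioid over
`RealifiedDivisorMonoids.ofRlfZWeak dm hpf` (`B₀^ℤ = B₀`, `F₀^ℤ = F₀`), modulo the typed Prop. 3.4 structure
`dm.Prop34` (`hP34Λ` = `ofRlfZWeak_mem_FΛ_of_divΛ_eq_of`) and the `B₀`-level inverse-closure `hF₀inv` of `F₀`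
(= `hFinv` at `ofRlfZWeak`, `ofRlfZWeak_hFinv_iff`). [cite: MochizukiEtTh2009, Rmk 3.6.3 p.79] -/
theorem remark363_ofRlfZWeak (C : TemperedFrobenioid (RealifiedDivisorMonoids.ofRlfZWeak dm hpf) D VD)
    (h34 : dm.Prop34 V V₀)
    (hF₀inv : ∀ (Y : D₀ᵒᵖ) (b : dm.B₀.obj Y), b ∈ dm.F₀ Y → ∃ b' ∈ dm.F₀ Y, b' * b = 1) :
    TemperedFrobenioid.Remark363 (T := RealifiedDivisorMonoids.ofRlfZWeak dm hpf) C :=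
  C.remark363_of_isSharp
    (fun A => Exists.elim (C.isPerfFactorial (op A)) fun hw _ => hw.isDivisorial.isSharp)
    (RealifiedDivisorMonoids.ofRlfZWeak_mem_FΛ_of_divΛ_eq_of dm hpf h34)
    ((RealifiedDivisorMonoids.ofRlfZWeak_hFinv_iff dm hpf).2 hF₀inv)

/-- **[EtTh] Remark 3.6.3 at monoid type `ℚ` over the WEAK vocabulary** for every tempered Frobenioid over
`RealifiedDivisorMonoids.ofRlfQWeak dm hpf` (`B₀^ℚ = B₀^pf`, `F₀^ℚ = F₀^pf`), modulo `dm.Prop34`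
(`hP34Λ` = `Prop34Cnst.ofRlfQWeak_mem_FΛ_of_divΛ_eq_of'`) and `hF₀inv` (`hFinv` = `ofRlfQWeak_hFinv_of'`).
[cite: MochizukiEtTh2009, Rmk 3.6.3 p.79] -/
theorem remark363_ofRlfQWeak (C : TemperedFrobenioid (RealifiedDivisorMonoids.ofRlfQWeak dm hpf) D VD)
    (h34 : dm.Prop34 V V₀)
    (hF₀inv : ∀ (Y : D₀ᵒᵖ) (b : dm.B₀.obj Y), b ∈ dm.F₀ Y → ∃ b' ∈ dm.F₀ Y, b' * b = 1) :
    TemperedFrobenioid.Remark363 (T := RealifiedDivisorMonoids.ofRlfQWeak dm hpf) C :=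
  C.remark363_of_isSharp
    (fun A => Exists.elim (C.isPerfFactorial (op A)) fun hw _ => hw.isDivisorial.isSharp)
    (RealifiedDivisorMonoids.Prop34Cnst.ofRlfQWeak_mem_FΛ_of_divΛ_eq_of' h34)
    (RealifiedDivisorMonoids.ofRlfQWeak_hFinv_of' dm hpf hF₀inv)

/-- The `Λ = ℝ` weak data packaged from abc-iut-L2-t3's typed Prop 3.4 over the weak vocabulary
(`ofRlfRWeakOfProp34`): Remark 3.6.3 UNCONDITIONALLY. [cite: MochizukiEtTh2009, Rmk 3.6.3 p.79] -/
theorem remark363_ofRlfRWeakOfProp34 {V₀' : FrdICatStub.{u, v, w} D₀}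
    (h34 : dm.Prop34 treeMonoidVocabWeak.{w} V₀')
    (C : TemperedFrobenioid (RealifiedDivisorMonoids.ofRlfRWeakOfProp34 dm h34) D VD) :
    TemperedFrobenioid.Remark363 (T := RealifiedDivisorMonoids.ofRlfRWeakOfProp34 dm h34) C :=
  remark363_ofRlfRWeak C

/-- The `Λ = ℤ` weak data packaged from the typed Prop 3.4 over the weak vocabulary (`ofRlfZWeakOfProp34`):
Remark 3.6.3 modulo `hF₀inv` only (Prop 3.4 is the package's own hypothesis).
[cite: MochizukiEtTh2009, Rmk 3.6.3 p.79] -/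
theorem remark363_ofRlfZWeakOfProp34 {V₀' : FrdICatStub.{u, v, w} D₀}
    (h34 : dm.Prop34 treeMonoidVocabWeak.{w} V₀')
    (C : TemperedFrobenioid (RealifiedDivisorMonoids.ofRlfZWeakOfProp34 dm h34) D VD)
    (hF₀inv : ∀ (Y : D₀ᵒᵖ) (b : dm.B₀.obj Y), b ∈ dm.F₀ Y → ∃ b' ∈ dm.F₀ Y, b' * b = 1) :
    TemperedFrobenioid.Remark363 (T := RealifiedDivisorMonoids.ofRlfZWeakOfProp34 dm h34) C :=
  remark363_ofRlfZWeak C h34 hF₀inv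

end TemperedFrobenioid

end Literature.AnabelianGeometry.EtaleTheta
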